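import Summits.NavierStokesRegularity.NavierStokesRegularity.Theorems.TypeILiouvilleTypeIliouvilleNoTypeIIEternalEnergyLiouvilleCore
import Summits.NavierStokesRegularity.NavierStokesRegularity.Theorems.TypeILiouvilleTypeIliouvilleNoTypeIIEternalEnergyLiouvilleLineInvariantAnyDirection
import HarnessLib

/-!
# EEL′ reduces to its genuinely three-dimensional core (crux `TypeIliouvilleNoTypeII`,
# stmt-NavierStokesRegularity-0056; rigidity residual EEL′ of the pressure-free eternal split)

Helper file (theorems only) — the capstone `eternalLiouvillePressureFree_of_core` (p484168) refined
by the 2½-dimensional stratum (`lineInvariant_eq_zero_of_ne_zero`, p486346): the pressure-free eternal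
energy Liouville statement EEL′ follows from its restriction to members of the class that are

  EXTREMAL (`‖W‖ ≤ ‖W(0,0)‖`), NOT time-independent, NOT time-periodic, NOT axisymmetric-without-swirl,
  NOT discretely self-similar, and WITHOUT any translation-invariant direction
  (`¬ ∃ e ≠ 0, W(t, x + δe) = W(t, x)`).

* `eternalLiouvillePressureFree_of_core3D` — **EEL′ ⟸ EEL′_core3D**, both in the exact `hEEL` shape.

Typed residual for the planners: a Liouville theorem for transient, genuinely three-dimensional (no
continuous translation symmetry), non-axisymmetric-swirl-free, non-self-similar, extremal eternal
profiles in the energy class.  WHAT THIS IS NOT: not NS; EEL′_core3D is OPEN. [folklore]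
-/

noncomputable section

-- the summit and its single problem share the name `NavierStokesRegularity` (D-0017 nested layout)
set_option linter.dupNamespace false

open Set Function Filter Topology MeasureTheory Metric
open scoped NNReal ENNReal

namespace Summit.NavierStokesRegularity.NavierStokesRegularity.Theorems.TypeIliouvilleNoTypeII.TypeIIZoom

open Literature.Analysis Literature.Analysis.FluidPDE

/-- **EEL′ follows from EEL′ on the genuinely three-dimensional core.**  Suppose every jointly
smooth, divergence-free, eternal Oseen-mild field `W` on `ℝ × ℝ³` with `A_ess, C, E ≤ I` (`I ≠ ∞`) on
all parabolic balls which is extremal, not time-independent, not time-periodic, not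
axisymmetric-without-swirl, not discretely self-similar AND has no translation-invariant direction
satisfies `W(0, 0) = 0`.  Then EEL′ holds. [cite: KochNadirashviliSereginSverak2009, Thms 5.1–5.2, Lemma 6.1, Prop. 4.1 (arXiv:0709.3599 pp. 8–13)] -/
theorem eternalLiouvillePressureFree_of_core3D
    (hcore : ∀ W : ℝ → EuclideanSpace ℝ (Fin 3) → EuclideanSpace ℝ (Fin 3),
      ContDiff ℝ (⊤ : ℕ∞) (uncurry W) → (∀ t, VectorCalculus.IsDivFree (W t)) →
      (∀ s t : ℝ, s < t → ∀ x, W t x = heatFlow (W s) (t - s) x - oseenDuhamel 1 s W W t x) →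
      (∀ t x, ‖W t x‖ ≤ ‖W 0 0‖) →
      (∃ I : ℝ≥0∞, I ≠ ⊤ ∧ ∀ r : ℝ, 0 < r → ∀ z : ℝ × EuclideanSpace ℝ (Fin 3),
        cknAEss r z W ≤ I ∧ cknC r z W ≤ I ∧ cknE r z (fun s y => fderiv ℝ (W s) y) ≤ I) →
      ¬ (∀ (t : ℝ) (y : EuclideanSpace ℝ (Fin 3)), W t y = W 0 y) →
      ¬ (∃ P : ℝ, 0 < P ∧ ∀ (t : ℝ) (x : EuclideanSpace ℝ (Fin 3)), W (t + P) x = W t x) →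
      ¬ ((∀ t, IsAxisymmetric (W t)) ∧ ∀ t, HasNoSwirl (W t)) →
      ¬ (∃ μ : ℝ, 1 < μ ∧ ∀ (s : ℝ) (y : EuclideanSpace ℝ (Fin 3)), W s y = μ • W (μ ^ 2 * s) (μ • y)) →
      ¬ (∃ e : EuclideanSpace ℝ (Fin 3), e ≠ 0 ∧
          ∀ (t : ℝ) (x : EuclideanSpace ℝ (Fin 3)) (δ : ℝ), W t (x + δ • e) = W t x) →
      W 0 0 = 0)
    (v : ℝ → EuclideanSpace ℝ (Fin 3) → EuclideanSpace ℝ (Fin 3))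
    (hv : ContDiff ℝ (⊤ : ℕ∞) (uncurry v)) (hdiv : ∀ t, VectorCalculus.IsDivFree (v t))
    (hmild : ∀ s t : ℝ, s < t → ∀ x, v t x = heatFlow (v s) (t - s) x - oseenDuhamel 1 s v v t x)
    (hbd : ∀ (t : ℝ) (x : EuclideanSpace ℝ (Fin 3)), ‖v t x‖ ≤ 2)
    (hI : ∃ I : ℝ≥0∞, I ≠ ⊤ ∧ ∀ r : ℝ, 0 < r → ∀ z : ℝ × EuclideanSpace ℝ (Fin 3),
      cknAEss r z v ≤ I ∧ cknC r z v ≤ I ∧ cknE r z (fun s y => fderiv ℝ (v s) y) ≤ I) :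
    v 0 0 = 0 := by
  refine eternalLiouvillePressureFree_of_core ?_ v hv hdiv hmild hbd hI
  intro W hW hWdiv hWmild hWsup hWI hsteady hper haxi hdss
  by_cases hline : ∃ e : EuclideanSpace ℝ (Fin 3), e ≠ 0 ∧
      ∀ (t : ℝ) (x : EuclideanSpace ℝ (Fin 3)) (δ : ℝ), W t (x + δ • e) = W t x
  · obtain ⟨e, he, hinv⟩ := hline
    obtain ⟨I, hItop, hball⟩ := hWI
    exact lineInvariant_eq_zero_of_ne_zero hW hWdiv hWmild ⟨‖W 0 0‖, hWsup⟩ he hinv hItop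
      (fun r hr z => (hball r hr z).1) 0 0
  · exact hcore W hW hWdiv hWmild hWsup hWI hsteady hper haxi hdss hline

end Summit.NavierStokesRegularity.NavierStokesRegularity.Theorems.TypeIliouvilleNoTypeII.TypeIIZoom

end
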